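import Summits.Ventures.LatticeQCDFlow.Scaling.HomStarPathLumping
import Summits.Ventures.LatticeQCDFlow.Scaling.HomStarSharpLaw
import Summits.Ventures.LatticeQCDFlow.Scaling.LumpedStarStepSampleSize
import Summits.Ventures.LatticeQCDFlow.Scaling.StarCycleCertificateLaw

/-!
HONEST FRAMING: exact (Metropolis-corrected) sampling algorithms for lattice gauge theory; figures
of merit are autocorrelation/cost numbers at stated couplings and volumes; no continuum-physics
claim.

# HomStarSampleSize — THE HONEST SAMPLE SIZE OF THE HOMOGENEOUS REPLICA-EXCHANGE STAR FOR POOLED OBSERVABLES, IN SCHEME STEPS, AT EVERY SWAP RATE: BURN-IN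
# `r ≥ (96(c+2K+2)(t+h)/(t·h·p̄))·log((4D(c+2K+2)(t+h)/(t·p̄))/ε)`, RUN `N ≥ (4Var_{π_S}(g)/(η²ε))·(c+2K+2)(t+h)/(2·t·h·p̄)` ⇒ `P_y{|N⁻¹Σ_{s<N} g(ΛX_{r+s}) − E_{π_S}g| ≥ η} ≤ ε`
# (lean-2 GEN-44, ours)

Venture-side (OURS).  Cell `lqcd-flow` (pub-lqcd), unit `pub-lqcd-lean-2-g44`, 2026-08-31.  Chapter AD, file 14 = the practical form of files 10–13: Levin–Peres–Wilmer Theorem 12.21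
(in the tree) for the LAZY LUMPED chain `S_l = (t+h)S_σ + (1−t−h)I` (`h = (1−t)w_0`, `σ = t/(t+h)`; row-stochastic, `π_S`-reversible, irreducible by X5∕X7 and file 13's lazy toolkit), its gap
`γ(S_l) = (t+h)γ(S_σ) ≥ 2thp̄/((t+h)(c+2K+2))` (file 13 + chapter AD file 5), its burn-in from chapter AD file 3 through the lazy decay of file 9 (`d_{S_l}(n) ≤ (2D/r)(1 − (t+h)(1−β))ⁿ ≤ (2D/r)e^{−an}`,
`a ≥ thp̄/(96(c+2K+2)(t+h))`), and file 13's PATH LUMPING to read the conclusion as a statement about the scheme's trajectories `g(ΛX_s)`.  Hypotheses: those of file 10 plus X6's resolvent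
end-hub laws ∕ couplings ∕ cycle chain (for file 5's gap), `|X| ≥ 2`.

* **`homStar_pooled_timeAverage`**.

Reading (no numerics implied): burn in `O((K/(p̄·min{t,h}))·log(K³(t+h)/(tp̄ε)))` scheme steps, then average `O(Var·K(t+h)/(t·h·p̄·η²ε))` scheme steps: the honest sample size for pooled (exchangeable)
observables of `K` identical replicas behind one persistent hot sampler is law-free at every swap fraction; the mean is the lumped stationary mean `E_{π_S}g`.  NOT CLAIMED: anything measured;
the labelled chain's own statistics.  Literature grade (cell rule): OWN COMPOSITION on the typed [LevinPeres2017, Thm 12.21]; nothing new cited; no new bib keys.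
-/

noncomputable section
open Finset Function
open Literature.Probability.MarkovChains

namespace Summit.Ventures.LatticeQCDFlow.Scaling

section PooledSampleSize
variable {S : Type*} [Fintype S] [DecidableEq S] {K m : ℕ} {μ : Fin (K + 1) → S → ℝ} {M : Fin (K + 1) → S → S → ℝ} {w : Fin (K + 1) → ℝ} {t : ℝ}
variable (κ : Fin m → Fin K)
variable {X : Type*} [Fintype X] [DecidableEq X]
variable {hub : X → S} {comp : X → S → ℕ} {W θ : S → ℝ} {p σ c C : ℝ} {acc : S → S → ℝ} {Kh : (S → ℕ) → S → S → ℝ}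
variable {u ut : X → S → ℝ} {qt q : X → X → S → S → ℝ} {P : X → X → ℝ} {Q : Matrix (X × X) (X × X) ℝ}
variable {Δ : (S → ℕ) → (S → ℕ) → ℕ} {F Ψ : X × X → ℝ}
variable {NCf : X → X → S → ℕ} {af bf : X → X → S} {PXf PYf : X → X → Option S → Option S → ℝ} {xtf ytf xsf ysf : X → X → Option S → ℝ}
variable {Ast Bst Ust Sst : X → X → ℝ} {g : (S → ℕ) → ℝ} {πS : X → ℝ} {Z : ℝ}
variable {Λ : (Fin (K + 1) → S) → X}

/-- The burn-in arithmetic of `homStar_pooled_timeAverage`, scalars only: with `q = t + (1−t)·w₀`,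
`σ = t/q`, `rr = σ·p̄/(c+2K+2)` and `ε' = (1−σ)·rr/48`, the lazy decay factor `1 − q + q·(1+ε')⁻¹`, raised to any
`r ≥ (96 (c+2K+2) q / (t (1−t) w₀ p̄)) · log((2((K+1)(c+2K+2)+C)(c+2K+2) q/(t p̄)) / (ε/2))`, brings the constant
`2((K+1)(c+2K+2)+C)/rr` below `ε/2` (the computation of file 12, isolated so that the main theorem stays light). [ours] -/
private theorem burnIn_scalar {t w₀ σ pb c C ε : ℝ} {K r : ℕ} (ht0 : 0 < t) (hh0 : 0 < (1 - t) * w₀)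
    (hq1 : t + (1 - t) * w₀ ≤ 1) (hσ : σ = t / (t + (1 - t) * w₀)) (hgap : 0 < pb) (hpbar : pb ≤ 1 / 2)
    (hc : 2 * (K : ℝ) + 4 ≤ c) (hD0 : 0 < ((K : ℝ) + 1) * (c + 2 * K + 2) + C) (hε : 0 < ε)
    (hr : 96 * (c + 2 * K + 2) * (t + (1 - t) * w₀) / (t * ((1 - t) * w₀) * pb)
        * Real.log ((2 * (((K : ℝ) + 1) * (c + 2 * K + 2) + C) * (c + 2 * K + 2) * (t + (1 - t) * w₀) / (t * pb)) / (ε / 2)) ≤ r) :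
    2 * (((K : ℝ) + 1) * (c + 2 * K + 2) + C) / (σ * pb / (c + 2 * K + 2))
        * (1 - (t + (1 - t) * w₀) + (t + (1 - t) * w₀) * (1 + (1 - σ) * (σ * pb / (c + 2 * K + 2)) / 48)⁻¹) ^ r ≤ ε / 2 := by
  have hq0 : 0 < t + (1 - t) * w₀ := by linarith
  have hσ0 : 0 < σ := by rw [hσ]; exact div_pos ht0 hq0
  have hσ1 : σ < 1 := by rw [hσ, div_lt_one hq0]; linarith
  have hcK : 0 < c + 2 * K + 2 := by linarith
  have hε2 : 0 < ε / 2 := by linarith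
  obtain ⟨rr, hrr⟩ : ∃ rr : ℝ, rr = σ * pb / (c + 2 * K + 2) := ⟨_, rfl⟩
  obtain ⟨ε', hε'⟩ : ∃ e : ℝ, e = (1 - σ) * rr / 48 := ⟨_, rfl⟩
  obtain ⟨Cst, hCst⟩ : ∃ C' : ℝ, C' = 2 * (((K : ℝ) + 1) * (c + 2 * K + 2) + C) / rr := ⟨_, rfl⟩
  rw [← hrr, ← hε', ← hCst]
  have hrr0 : 0 < rr := by rw [hrr]; exact div_pos (mul_pos hσ0 hgap) hcK
  have hε'0 : 0 < ε' := by rw [hε']; exact div_pos (mul_pos (by linarith) hrr0) (by norm_num)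
  have hε'1 : ε' ≤ 1 := by
    rw [hε']
    have h1 : σ * pb ≤ 1 * (1 / 2) := mul_le_mul hσ1.le hpbar hgap.le zero_le_one
    have h2 : rr ≤ 1 := by rw [hrr, div_le_one hcK]; linarith only [h1, hc, (Nat.cast_nonneg K : (0 : ℝ) ≤ K)]
    nlinarith only [h2, hrr0, hσ0, hσ1]
  obtain ⟨a, ha⟩ : ∃ a : ℝ, a = (t + (1 - t) * w₀) * (1 - (1 + ε')⁻¹) := ⟨_, rfl⟩
  obtain ⟨alow, halow⟩ : ∃ a' : ℝ, a' = t * ((1 - t) * w₀) * pb / (96 * (c + 2 * K + 2) * (t + (1 - t) * w₀)) := ⟨_, rfl⟩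
  have halow0 : 0 < alow := by rw [halow]; exact div_pos (mul_pos (mul_pos ht0 hh0) hgap) (by positivity)
  have h1β : ε' / 2 ≤ 1 - (1 + ε')⁻¹ := by
    rw [show 1 - (1 + ε')⁻¹ = ε' / (1 + ε') by field_simp; ring]
    exact div_le_div_of_nonneg_left hε'0.le (by linarith) (by linarith)
  have haa : alow ≤ a := by
    rw [ha, halow]
    have hq1' : (t + (1 - t) * w₀) * (ε' / 2) ≤ (t + (1 - t) * w₀) * (1 - (1 + ε')⁻¹) := mul_le_mul_of_nonneg_left h1β hq0.le
    have e : (t + (1 - t) * w₀) * (ε' / 2) = t * ((1 - t) * w₀) * pb / (96 * (c + 2 * K + 2) * (t + (1 - t) * w₀)) := by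
      rw [hε', hrr, hσ]; field_simp; ring
    linarith
  have ha1 : a ≤ 1 := by
    rw [ha]
    have hb1 : 1 - (1 + ε')⁻¹ ≤ 1 := by have := inv_nonneg.mpr (by linarith : (0:ℝ) ≤ 1 + ε'); linarith
    have hb0 : 0 ≤ 1 - (1 + ε')⁻¹ := by linarith
    calc (t + (1 - t) * w₀) * (1 - (1 + ε')⁻¹) ≤ 1 * 1 := mul_le_mul hq1 hb1 hb0 zero_le_one
      _ = 1 := one_mul 1
  have hpow : (1 - a) ^ r ≤ Real.exp (-alow * r) := by
    calc (1 - a) ^ r ≤ (Real.exp (-a)) ^ r := pow_le_pow_left₀ (by linarith) (Real.one_sub_le_exp_neg a) r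
      _ = Real.exp (-a * r) := by rw [← Real.exp_nat_mul]; ring_nf
      _ ≤ Real.exp (-alow * r) := Real.exp_le_exp.mpr (mul_le_mul_of_nonneg_right (neg_le_neg haa) (Nat.cast_nonneg r))
  have hCst0 : 0 < Cst := by rw [hCst]; exact div_pos (by linarith) hrr0
  have e0 : 1 - (t + (1 - t) * w₀) + (t + (1 - t) * w₀) * (1 + ε')⁻¹ = 1 - a := by rw [ha]; ring
  rw [e0]
  calc Cst * (1 - a) ^ r ≤ Cst * Real.exp (-alow * r) := mul_le_mul_of_nonneg_left hpow hCst0.le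
    _ ≤ ε / 2 := by
        refine exp_le_of_ge_log halow0 hCst0 hε2 ?_
        have ht' : t ≠ 0 := ht0.ne'
        have hpb' : pb ≠ 0 := hgap.ne'
        have hq' : t + (1 - t) * w₀ ≠ 0 := hq0.ne'
        have hc' : c + 2 * K + 2 ≠ 0 := hcK.ne'
        have hw' : (1 - t) * w₀ ≠ 0 := hh0.ne'
        have e1 : 1 / alow = 96 * (c + 2 * K + 2) * (t + (1 - t) * w₀) / (t * ((1 - t) * w₀) * pb) := by
          rw [halow, one_div, inv_div]
        have e2 : Cst = 2 * (((K : ℝ) + 1) * (c + 2 * K + 2) + C) * (c + 2 * K + 2) * (t + (1 - t) * w₀) / (t * pb) := by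
          rw [hCst, hrr, hσ, div_div_eq_mul_div]
          rw [div_eq_div_iff (mul_ne_zero (div_ne_zero ht' hq') hpb') (mul_ne_zero ht' hpb')]
          rw [show t / (t + (1 - t) * w₀) * pb = t * pb / (t + (1 - t) * w₀) by ring, mul_div_assoc', eq_div_iff hq']
          ring
        rw [e1, e2]; exact hr

/-- **THE HONEST SAMPLE SIZE FOR POOLED OBSERVABLES OF THE HOMOGENEOUS REPLICA-EXCHANGE STAR** (see the module docstring). [ours] -/
theorem homStar_pooled_timeAverage [Nonempty X] [Nontrivial X] (hm : 1 ≤ m) (hμ : ∀ k x, 0 < μ k x) (hμsum : ∀ k, ∑ u, μ k u = 1) (hhom : ∀ i : Fin K, μ i.succ = μ 1)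
    (hw0 : ∀ k, 0 ≤ w k) (hw00 : 0 < w 0) (hw1 : ∑ k, w k = 1) (ht0 : 0 < t) (ht1 : t < 1)
    (hM0 : ∀ u v, M 0 u v = μ 0 v) (hidle : ∀ i : Fin K, ∀ u v, M i.succ u v = if v = u then 1 else 0)
    {c' : ℕ} (hunif : ∀ i : Fin K, (univ.filter fun r : Fin m => κ r = i).card = c')
    (hWdef : ∀ v, W v = μ 1 v / μ 0 v) (hinj : ∀ x x', hub x = hub x' → comp x = comp x' → x = x') (hsum : ∀ x, ∑ v, comp x v = K + 1)
    (hsurj : ∀ (z : S) (N : S → ℕ), ∑ v, N v = K + 1 → N z ≠ 0 → ∃ x, hub x = z ∧ comp x = N) (hhub : ∀ x, comp x (hub x) ≠ 0) (hK : 2 ≤ K)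
    (hW : ∀ v, 0 < W v) (hp0 : 0 ≤ p) (hp : ∀ v, p * W v ≤ 1) (hθ : ∀ v, θ v = 1 / (1 + p * W v)) (hacc : ∀ h v, acc h v = min 1 (W h / W v))
    (hc : 2 * (K : ℝ) + 4 ≤ c) (hσ : σ = t / (t + (1 - t) * w 0))
    (hgap : 0 < p * ∑ v, μ 0 v * (W v * θ v))
    (hKoff : ∀ N h v, h ≠ v → Kh N h v = if N h = 0 then 0 else (N v : ℝ) / K * acc h v) (hKdiag : ∀ N h, Kh N h h = 1 - ∑ v ∈ univ.erase h, Kh N h v)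
    (hΔ : ∀ N N', Δ N N' = ∑ v, (N v - N' v))
    (hF : ∀ x y, F (x, y) = c + (-(1 - σ) * θ (hub x)) + (-(1 - σ) * θ (hub y)) + ∑ v, θ v * ((comp x v : ℝ) + (comp y v : ℝ)))
    (hC : C = 2 * ((K + 1) * (c + 2 * K + 6)))
    (hΨ : ∀ x y, Ψ (x, y) = (Δ (comp x) (comp y) : ℝ) * F (x, y) + C * (if hub x = hub y then (0 : ℝ) else 1))
    -- the tagged data of every ORIENTED adjacent pair (as in W23 ∕ X6)
    (horient : ∀ x y, hub x = hub y → Δ (comp x) (comp y) = 1 → W (bf x y) ≤ W (af x y) ∨ W (bf y x) ≤ W (af y x))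
    (hcx : ∀ x y, hub x = hub y → Δ (comp x) (comp y) = 1 → W (bf x y) ≤ W (af x y) → comp x = NCf x y + Pi.single (af x y) 1)
    (hcy : ∀ x y, hub x = hub y → Δ (comp x) (comp y) = 1 → W (bf x y) ≤ W (af x y) → comp y = NCf x y + Pi.single (bf x y) 1)
    (hPXoff : ∀ x y, hub x = hub y → Δ (comp x) (comp y) = 1 → W (bf x y) ≤ W (af x y) →
      ∀ h v, h ≠ v → PXf x y (some h) (some v) = if NCf x y h = 0 then 0 else (NCf x y v : ℝ) / K * acc h v)
    (hPXin : ∀ x y, hub x = hub y → Δ (comp x) (comp y) = 1 → W (bf x y) ≤ W (af x y) →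
      ∀ h, PXf x y (some h) none = if NCf x y h = 0 then 0 else acc h (af x y) / K)
    (hPXdiag : ∀ x y, hub x = hub y → Δ (comp x) (comp y) = 1 → W (bf x y) ≤ W (af x y) →
      ∀ h, PXf x y (some h) (some h) = 1 - (∑ v ∈ univ.erase h, PXf x y (some h) (some v) + PXf x y (some h) none))
    (hPXout : ∀ x y, hub x = hub y → Δ (comp x) (comp y) = 1 → W (bf x y) ≤ W (af x y) → ∀ v, PXf x y none (some v) = (NCf x y v : ℝ) / K * acc (af x y) v)
    (hPXstay : ∀ x y, hub x = hub y → Δ (comp x) (comp y) = 1 → W (bf x y) ≤ W (af x y) → PXf x y none none = 1 - ∑ v, PXf x y none (some v))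
    (hPYoff : ∀ x y, hub x = hub y → Δ (comp x) (comp y) = 1 → W (bf x y) ≤ W (af x y) →
      ∀ h v, h ≠ v → PYf x y (some h) (some v) = if NCf x y h = 0 then 0 else (NCf x y v : ℝ) / K * acc h v)
    (hPYin : ∀ x y, hub x = hub y → Δ (comp x) (comp y) = 1 → W (bf x y) ≤ W (af x y) →
      ∀ h, PYf x y (some h) none = if NCf x y h = 0 then 0 else acc h (bf x y) / K)
    (hPYdiag : ∀ x y, hub x = hub y → Δ (comp x) (comp y) = 1 → W (bf x y) ≤ W (af x y) →
      ∀ h, PYf x y (some h) (some h) = 1 - (∑ v ∈ univ.erase h, PYf x y (some h) (some v) + PYf x y (some h) none))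
    (hPYout : ∀ x y, hub x = hub y → Δ (comp x) (comp y) = 1 → W (bf x y) ≤ W (af x y) → ∀ v, PYf x y none (some v) = (NCf x y v : ℝ) / K * acc (bf x y) v)
    (hPYstay : ∀ x y, hub x = hub y → Δ (comp x) (comp y) = 1 → W (bf x y) ≤ W (af x y) → PYf x y none none = 1 - ∑ v, PYf x y none (some v))
    (hxtf : ∀ x y, hub x = hub y → Δ (comp x) (comp y) = 1 → W (bf x y) ≤ W (af x y) →
      ∀ t, xtf x y t = (1 - σ) * PXf x y (some (hub x)) t + σ * ∑ t', xtf x y t' * PXf x y t' t)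
    (hytf : ∀ x y, hub x = hub y → Δ (comp x) (comp y) = 1 → W (bf x y) ≤ W (af x y) →
      ∀ t, ytf x y t = (1 - σ) * PYf x y (some (hub x)) t + σ * ∑ t', ytf x y t' * PYf x y t' t)
    (hxsf : ∀ x y, hub x = hub y → Δ (comp x) (comp y) = 1 → W (bf x y) ≤ W (af x y) →
      ∀ t, xsf x y t = (1 - σ) * PXf x y none t + σ * ∑ t', xsf x y t' * PXf x y t' t)
    (hysf : ∀ x y, hub x = hub y → Δ (comp x) (comp y) = 1 → W (bf x y) ≤ W (af x y) →
      ∀ t, ysf x y t = (1 - σ) * PYf x y none t + σ * ∑ t', ysf x y t' * PYf x y t' t)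
    -- the step chain of the lumped star (file X5 `LumpedStarStepChain`)
    (hA : ∀ x x', Ast x x' = if comp x' = comp x then Kh (comp x) (hub x) (hub x') else 0)
    (hB : ∀ x x', Bst x x' = μ 0 (hub x') * (if comp x' + Pi.single (hub x) 1 = comp x + Pi.single (hub x') 1 then 1 else 0))
    (hS : ∀ x x', Sst x x' = σ * Ast x x' + (1 - σ) * Bst x x')
    (hg : ∀ N, g N = ∏ v, (μ 0 v * W v) ^ (N v) / ((N v).factorial : ℝ))
    (hZ : Z = ∑ x, g (comp x) * ((comp x (hub x) : ℝ) / W (hub x))) (hπS : ∀ x, πS x = g (comp x) * ((comp x (hub x) : ℝ) / W (hub x)) / Z)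
    (hΛh : ∀ y, hub (Λ y) = y 0) (hΛc : ∀ y v, comp (Λ y) v = (univ.filter fun k : Fin (K + 1) => y k = v).card)
    -- the resolvent end-hub laws, optimal tail couplings and cycle chain of chapter W file 27 (for the spectral gap, chapter AD file 5)
    (hu : ∀ x v, u x v = (1 - σ) * (if v = hub x then (1 : ℝ) else 0) + σ * ∑ h, u x h * Kh (comp x) h v)
    (hut : ∀ x v, ut x v = ∑ h, u x h * Kh (comp x) h v)
    (hqt : ∀ x y a b, qt x y a b = optimalCoupling (ut x) (ut y) a b)
    (hq : ∀ x y a b, q x y a b = (1 - σ) * ((if a = hub x then (1 : ℝ) else 0) * (if b = hub y then (1 : ℝ) else 0)) + σ * qt x y a b)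
    (hP : ∀ x x', P x x' = ∑ a, u x a * (μ 0 (hub x') * (if comp x' + Pi.single a 1 = comp x + Pi.single (hub x') 1 then (1 : ℝ) else 0)))
    (hQ : ∀ x y x' y', Q (x, y) (x', y') = ∑ a, ∑ b, q x y a b * (μ 0 (hub x')
      * (if comp x' + Pi.single a 1 = comp x + Pi.single (hub x') 1 then (1 : ℝ) else 0))
      * ((if hub y' = hub x' then (1 : ℝ) else 0) * (if comp y' + Pi.single b 1 = comp y + Pi.single (hub y') 1 then (1 : ℝ) else 0)))
    (hUst : ∀ x x', Ust x x' = if comp x' = comp x then u x (hub x') else 0)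
    (gobs : X → ℝ) {ε η : ℝ} (hε : 0 < ε) (hη : 0 < η) {r N : ℕ}
    (hr : 96 * (c + 2 * K + 2) * (t + (1 - t) * w 0) / (t * ((1 - t) * w 0) * (p * ∑ v, μ 0 v * (W v * θ v)))
        * Real.log ((2 * (((K : ℝ) + 1) * (c + 2 * K + 2) + C) * (c + 2 * K + 2) * (t + (1 - t) * w 0) / (t * (p * ∑ v, μ 0 v * (W v * θ v)))) / (ε / 2)) ≤ r)
    (hN : 0 < N)
    (hNvar : 4 * lawVariance πS gobs / (η ^ 2 * ε) * ((c + 2 * K + 2) * (t + (1 - t) * w 0) / (2 * t * ((1 - t) * w 0) * (p * ∑ v, μ 0 v * (W v * θ v)))) ≤ N)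
    (y : Fin (K + 1) → S) :
    pathSum (Matrix.of fun a b => t * ptGraphSwap μ (fun r : Fin m => (((0 : Fin (K + 1)), (κ r).succ) : Fin (K + 1) × Fin (K + 1))) (fun _ : Fin m => Equiv.refl S) a b
          + (1 - t) * prodKernel w M a b) (N + r) y (fun ω =>
        if η ≤ |(∑ s : Fin N, gobs (Λ ((Matrix.vecCons y ω : Fin (N + r + 1) → (Fin (K + 1) → S)) ⟨(s : ℕ) + r, by have := s.isLt; omega⟩))) / N - lawMean πS gobs|
          then (1 : ℝ) else 0) ≤ ε := by
  classical
  -- §0 scalars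
  have hK1 : 1 ≤ K := le_trans (by norm_num) hK
  have hK0 : (0 : ℝ) ≤ K := Nat.cast_nonneg _
  have hh0 : 0 < (1 - t) * w 0 := mul_pos (by linarith) hw00
  have hq0 : 0 < t + (1 - t) * w 0 := by linarith
  have hw01 : w 0 ≤ 1 := by
    calc w 0 ≤ ∑ k, w k := single_le_sum (fun k _ => hw0 k) (mem_univ 0)
      _ = 1 := hw1
  have hq1 : t + (1 - t) * w 0 ≤ 1 := by nlinarith [hw0 0]
  have hσ0 : 0 < σ := by rw [hσ]; exact div_pos ht0 hq0
  have hσ1 : σ < 1 := by rw [hσ, div_lt_one hq0]; linarith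
  have hcK : 0 < c + 2 * K + 2 := by linarith
  have hacc' : ∀ u v, acc u v = min 1 (μ 0 v * μ 1 u / (μ 0 u * μ 1 v)) := by
    intro u v
    rw [hacc, hWdef, hWdef]
    congr 1
    have h1 := hμ 0 u; have h2 := hμ 0 v; have h3 := hμ 1 u; have h4 := hμ 1 v
    field_simp
  -- §1 the lazy lumped chain and its structure
  obtain ⟨Sl, hSl⟩ : ∃ Sl : X → X → ℝ, ∀ x x', Sl x x' = t * Ast x x' + (1 - t) * (w 0 * Bst x x' + (1 - w 0) * (if x = x' then 1 else 0)) :=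
    ⟨_, fun _ _ => rfl⟩
  have hSl' : ∀ x x', Sl x x' = (t + (1 - t) * w 0) * Sst x x' + (1 - (t + (1 - t) * w 0)) * (if x = x' then 1 else 0) := by
    intro x x'; rw [hSl, hS, hσ]; have hq' : (t + (1 - t) * w 0) ≠ 0 := hq0.ne'; field_simp; ring
  have hπ := lumpedStar_piS_pos hhub hW (hμ 0) hg hZ hπS
  have hπ1 := lumpedStar_piS_sum hhub hW (hμ 0) hg hZ hπS
  have hA0 : ∀ x x', 0 ≤ Ast x x' := starStep_swap_nonneg hW hacc hK1 hsum hKoff hKdiag hA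
  have hA1 : ∀ x, ∑ x', Ast x x' = 1 := starStep_swap_rowsum hinj hsurj hhub hsum hKoff hKdiag hA
  have hArev : ∀ x x', πS x * Ast x x' = πS x' * Ast x' x := starStep_swap_reversible hinj hhub hW hacc hKoff hA hπS
  have hB0 : ∀ x x', 0 ≤ Bst x x' := fun x x' => by rw [hB]; exact mul_nonneg (hμ 0 _).le (by split_ifs <;> norm_num)
  have hB1 : ∀ x, ∑ x', Bst x x' = 1 := starStep_redraw_rowsum hinj hsurj hhub hsum (hμsum 0) hB
  have hBrev : ∀ x x', πS x * Bst x x' = πS x' * Bst x' x := starStep_redraw_reversible hhub hW hg hπS hB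
  have hSrs : IsRowStochastic Sst := stepChain_rowStochastic hA0 hA1 hB0 hB1 hσ0.le hσ1 hS
  have hDB : DetailedBalance πS Sst := stepChain_detailedBalance hArev hBrev hS
  have hirr := lumpedStar_step_irreducible hsurj hhub hW hacc hK1 hsum hKoff hKdiag (hμ 0) hσ0 hσ1 hA hB hS
  have hSlrs : IsRowStochastic Sl := lazyq_isRowStochastic (S := Sst) hSrs hq0.le hq1 hSl'
  have hSlDB : DetailedBalance πS Sl := lazyq_detailedBalance (S := Sst) hDB hSl'
  have hSlirr : Literature.Probability.MarkovChains.IsIrreducible Sl := lazyq_isIrreducible (S := Sst) hSrs.1 hq0 hq1 hSl' hirr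
  -- §2 the gap of `S_l`
  have hgapS := lumpedStar_step_spectralGap_ge hinj hsum hsurj hhub hK hW hp0 hp hθ hacc (fun v => (hμ 0 v).le) (hμsum 0) (hμ 0) hc hσ0 hσ1 hgap hKoff hKdiag hΔ hF hC hΨ horient hcx hcy hPXoff hPXin hPXdiag hPXout hPXstay hPYoff hPYin hPYdiag hPYout hPYstay hxtf hytf hxsf hysf hA hB hS hg hZ hπS hu hut hqt hq hP hQ hUst
  have hgapL : (t + (1 - t) * w 0) * ((1 - σ) * (2 * σ * (p * ∑ v, μ 0 v * (W v * θ v)) / (c + 2 * K + 2))) ≤ spectralGap πS Sl := by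
    rw [spectralGap_lazyq (S := Sst) hπ hπ1 hSrs hDB hq0.le hq1 hSl']
    exact mul_le_mul_of_nonneg_left hgapS hq0.le
  have hGeq : (t + (1 - t) * w 0) * ((1 - σ) * (2 * σ * (p * ∑ v, μ 0 v * (W v * θ v)) / (c + 2 * K + 2)))
      = 2 * t * ((1 - t) * w 0) * (p * ∑ v, μ 0 v * (W v * θ v)) / ((c + 2 * K + 2) * (t + (1 - t) * w 0)) := by
    rw [hσ]; have hq' : (t + (1 - t) * w 0) ≠ 0 := hq0.ne'; field_simp; ring
  have hGpos : 0 < 2 * t * ((1 - t) * w 0) * (p * ∑ v, μ 0 v * (W v * θ v)) / ((c + 2 * K + 2) * (t + (1 - t) * w 0)) :=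
    div_pos (mul_pos (mul_pos (mul_pos two_pos ht0) hh0) hgap) (mul_pos hcK hq0)
  have hγinv : (spectralGap πS Sl)⁻¹ ≤ (c + 2 * K + 2) * (t + (1 - t) * w 0) / (2 * t * ((1 - t) * w 0) * (p * ∑ v, μ 0 v * (W v * θ v))) := by
    rw [hGeq] at hgapL
    calc (spectralGap πS Sl)⁻¹ ≤ (2 * t * ((1 - t) * w 0) * (p * ∑ v, μ 0 v * (W v * θ v)) / ((c + 2 * K + 2) * (t + (1 - t) * w 0)))⁻¹ :=
          inv_anti₀ hGpos hgapL
      _ = _ := by rw [inv_div]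
  -- §3 the burn-in: `d_{S_l}(r) ≤ ε/2`
  have hdec := lumpedStar_clock_worstTvDist_le hinj hsum hsurj hhub hK hW hp0 hp hθ hacc (fun v => (hμ 0 v).le) (hμsum 0) (hμ 0) hc hσ0 hσ1 hgap hKoff hKdiag hΔ hF hC hΨ horient hcx hcy hPXoff hPXin hPXdiag hPXout hPXstay hPYoff hPYin hPYdiag hPYout hPYstay hxtf hytf hxsf hysf hA hB hS hg hZ hπS
  have hβ0 : 0 ≤ (1 + (1 - σ) * (σ * (p * ∑ v, μ 0 v * (W v * θ v)) / (c + 2 * K + 2)) / 48)⁻¹ := by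
    have : 0 ≤ (1 - σ) * (σ * (p * ∑ v, μ 0 v * (W v * θ v)) / (c + 2 * K + 2)) / 48 :=
      div_nonneg (mul_nonneg (by linarith) (div_nonneg (mul_nonneg hσ0.le hgap.le) (by linarith))) (by norm_num)
    exact inv_nonneg.mpr (by linarith)
  have hlazy := lazy_worstTvDist_le (S := Sst) hSl' hq0.le hq1 hβ0 hdec r
  -- the burn-in `d_{S_l}(r) ≤ ε/2` (scalar lemma above)
  have hpbar : p * ∑ v, μ 0 v * (W v * θ v) ≤ 1 / 2 := by
    calc p * ∑ v, μ 0 v * (W v * θ v) = ∑ v, μ 0 v * (p * (W v * θ v)) := by rw [mul_sum]; exact sum_congr rfl fun v _ => by ring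
      _ ≤ ∑ v, μ 0 v * (1 / 2) := sum_le_sum fun v _ => mul_le_mul_of_nonneg_left (finiteOdds_pWθ_le_half hp0 hp hW hθ v) (hμ 0 v).le
      _ = 1 / 2 := by rw [← sum_mul, hμsum 0, one_mul]
  have hD0 : 0 < ((K : ℝ) + 1) * (c + 2 * K + 2) + C := by
    rw [hC]
    have h1 : 0 < ((K : ℝ) + 1) * (c + 2 * K + 2) := mul_pos (by linarith) hcK
    have h2 : 0 < ((K : ℝ) + 1) * (c + 2 * K + 6) := mul_pos (by linarith) (by linarith)
    linarith only [h1, h2]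
  have ht₀ : worstTvDist Sl πS r ≤ ε / 2 := hlazy.trans (burnIn_scalar ht0 hh0 hq1 hσ hgap hpbar hc hD0 hε hr)
  have hmix : mixingTime Sl πS (ε / 2) ≤ r := mixingTime_le Sl πS ht₀
  -- §4 Levin–Peres–Wilmer 12.21 for `S_l` from the lumped start `Λ y`
  have hV : 0 ≤ 4 * lawVariance πS gobs / (η ^ 2 * ε) :=
    div_nonneg (mul_nonneg (by norm_num) (lawVariance_nonneg (fun z => (hπ z).le) gobs)) (by positivity)
  have hLPW := LevinPeres2017_thm_12_21 hπ hπ1 hSlrs hSlDB hSlirr gobs hε hη ht₀ hmix hN ((mul_le_mul_of_nonneg_left hγinv hV).trans hNvar) (Λ y)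
  -- §5 path lumping (file 13): the scheme's trajectories through `Λ` are `S_l`'s
  have hpath := homStar_pushforward_pathSum κ hm hμ hhom hw1 hM0 hidle hunif hacc' hKoff hKdiag hA hB hSl hΛh hΛc hinj (N + r) y
    (fun ω' : Fin (N + r) → X => if η ≤ |(∑ s : Fin N, gobs ((Matrix.vecCons (Λ y) ω' : Fin (N + r + 1) → X) ⟨(s : ℕ) + r, by have := s.isLt; omega⟩)) / N - lawMean πS gobs|
      then (1 : ℝ) else 0)
  have hLPW' : pathSum (Matrix.of fun a b => Sl a b) (N + r) (Λ y)
      (fun ω' : Fin (N + r) → X => if η ≤ |(∑ s : Fin N, gobs ((Matrix.vecCons (Λ y) ω' : Fin (N + r + 1) → X) ⟨(s : ℕ) + r, by have := s.isLt; omega⟩)) / N - lawMean πS gobs|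
        then (1 : ℝ) else 0) ≤ ε := by
    have e : (Matrix.of fun a b => Sl a b) = Sl := by ext a b; rfl
    rw [e]; exact hLPW
  rw [← hpath] at hLPW'
  -- the two integrands agree: `vecCons (Λy) (Λ ∘ ω) = Λ ∘ vecCons y ω`
  have hcons : ∀ (ω : Fin (N + r) → Fin (K + 1) → S) (j : Fin (N + r + 1)),
      (Matrix.vecCons (Λ y) (fun i => Λ (ω i)) : Fin (N + r + 1) → X) j = Λ ((Matrix.vecCons y ω : Fin (N + r + 1) → (Fin (K + 1) → S)) j) := by
    intro ω j; refine Fin.cases ?_ (fun i => ?_) j <;> simp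
  refine le_of_eq_of_le ?_ hLPW'
  congr 1; funext ω
  simp only [hcons]

end PooledSampleSize

end Summit.Ventures.LatticeQCDFlow.Scaling

end
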